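import Summits.QuantumFields.YangMills.Theorems.BalabanUVNodesN18TransportedPairFactorisation
import Summits.QuantumFields.YangMills.Theorems.BalabanUVNodesN18TransportLettersOfRecord
import HarnessLib

/-!
# BalabanUVNodes ∕ node N18 = NE5 — closure-ledger item (iii): BOTH TRANSPORT CLAUSES OF N18's READING AT THE TABLE OF RECORD FROM NUMERICS AND THE
# REMAINING ANALYTIC LETTERS ONLY — FILE 7's ★★★★ with the letters `hUGc`, `Factors`, `CondI`, `A′ ∈ 𝔤ᶜ`, `|A′| ≤ a`, `|∇A′| ≤ a₁`, `l ∈ 𝔤ᶜ`, `e^{−l} ∈ Gᶜ`,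
# `Ad(e^{−l})𝔤ᶜ ⊆ 𝔤ᶜ` DISCHARGED for the candidate factor `U_A = fieldShift (avgUnits U)`, `A′ = (iη_j)⁻¹ log(Ū·U_A⁻¹)`
# (Track A, DAG node N18 = `T4OutputRate.NE5` :211; cluster K4 «SpineRates», item K3⁷ `SpineGivenEndpointR13SepCoPH`; seat pub-ymgap-dag-n18-w3 g4)

HONEST FRAMING.  Count-neutral kernel bookkeeping (`--supports stmt-QuantumFields-20544 --as helper`): composition BY NAME of FILE 7
(`admTransport_spaceOfRecord_unit_ofRecord_orbit_of_letters`, p607192) with this seat's g4 files B (`hUGc` at every frame bond), D∕E (condition (i) one run up) and F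
(C⁰ factorisation letters).  What is displayed — and NOT produced — is exactly the ANALYTIC remainder of the (β) programme per table point: the plaquette letter of the
COMPLEX `Ū`, a comb generator `l` (traceless, `|l| ≤ ξδ₀`, `|∇_{U_A} l| ≤ ξδ₁` on `Y`) with the CANCELLED sums `|A′ − i∇_{U_A} l| < s₀`, `|∇_{U_A}(A′ − i∇_{U_A} l)| < s₁`, and
the side conditions ∕ numerics on the radii ([Balaban1985Averaging] Prop. 3 + the comb step; the radii step law of the record).  Nothing of Bałaban's renormalization group
is asserted; NE5 NOT PRINTED ∕ NOT proved; N18 NOT discharged; nothing about the continuum ∕ OS ∕ mass gap ∕ Clay.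

WHAT.
* `nabla_congr` (a covariant derivative depends on the transporter at the bond and on the function at its two ends), `expUnit_neg_mem_Gc_of_trace`, `conj_mem_gc_of_mem`
  (for `suModel N`: `e^{−l} ∈ SL(N,ℂ)` and `Ad`-stability of `𝔰𝔩(N,ℂ)` from `tr l = 0`).
* ★★★★★ `admTransport_spaceOfRecord_unit_ofRecord_orbit_of_analyticLetters`: for settings `Sg` whose models are `suModel N` at runs `k`, `k+1`, radii `α₀ α₁`, a run-A
  (1.11)-radius `α₀A : ℕ → ℝ` for the averaged factor, the displayed PER-STEP NUMERICS (`hnum…`), and PER TABLE POINT `(j, Y, Φ)` and per factorisation `(U, A′)` of `Φ`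
  satisfying (i), (ii) of run B the REMAINING LETTERS `hrest` (stated on the explicit `U_A = fieldShift (avgUnits U)` and `A′_A = (iη_j)⁻¹ log(Ū·U_A⁻¹)`): BOTH transport
  clauses of N18's reading at the table of record (conclusion verbatim FILE 7's).

0 `def`, 0 `sorry`.  References: T. Bałaban, CMP **109** (1987) 249–301 [Balaban1987RG1] ((0.21)–(0.25) pp.256–257, (1.10)–(1.16) p.262); CMP **98** (1985) 17–51
[Balaban1985Averaging] (Props. 1–3 pp.26–36, (62)–(63) p.29).
-/

noncomputable section

open scoped BigOperators Matrix.Norms.L2Operator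

namespace YMDAG.N18.TransportOfRecord

open Complex (I)
open Literature.MathematicalPhysics.QuantumFieldTheory.Balaban1983to89
open Literature.MathematicalPhysics.QuantumFieldTheory.Balaban1983to89.T4Continuum
open Literature.MathematicalPhysics.QuantumFieldTheory.Balaban1983to89.T4LevelShift
open Literature.MathematicalPhysics.QuantumFieldTheory.Balaban1983to89.BlockAveraging
open Literature.MathematicalPhysics.QuantumFieldTheory.Balaban1983to89.B12RegularSpaces111
open Literature.MathematicalPhysics.QuantumFieldTheory.Balaban1983to89.B12RegularSpaces111SpecialUnitary (suModel mem_suModel_G mem_suModel_Gc mem_suModel_gc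
  suModel_norm_le suModel_G_le_Gc suModel_gc_conj suModel_gc_newPot)
open Literature.MathematicalPhysics.QuantumFieldTheory.Balaban1983to89.B12Membership313II (newPot)
open Literature.MathematicalPhysics.QuantumFieldTheory.Balaban1983to89.ExpMeanLog (deltaSU)
open Literature.MathematicalPhysics.QuantumFieldTheory.Balaban1983to89.MatrixLog (mlog)
open Literature.MathematicalPhysics.QuantumFieldTheory.Balaban1983to89.Node00 (MatA ιSU plaqInside)
open Literature.MathematicalPhysics.QuantumFieldTheory.Balaban1983to89.Node00.Sect2 (domSys domSites domCount CPair ofBackgroundC frameI Setting Residual regionOfSet)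
open Literature.MathematicalPhysics.QuantumFieldTheory.Balaban1983to89.Node00.W1
open Summit.QuantumFields.BalabanUV.T4Continuum.B13Carriers (transportRaw)

/-! ## §1 Three small letters: `∇` congruence, `e^{−l} ∈ SL(N,ℂ)`, `Ad`-stability of `𝔰𝔩(N,ℂ)` -/

section Small

variable {P : Params} {N : ℕ}

/-- A covariant derivative `∇^ξ_{U,μ}F(x)` depends only on `U(x, μ)`, `F(x)` and `F(x + e_μ)`. [cite: Balaban1987RG1, (1.13) p.262 (bookkeeping)] -/
theorem nabla_congr {i : ℕ} {ξ : ℝ} {U V : PBond P i → (MatA N)ˣ} {μ : Fin P.d} {F G : Site P i → MatA N} {x : Site P i}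
    (hU : U ⟨x, μ⟩ = V ⟨x, μ⟩) (h0 : F x = G x) (h1 : F (x.shift μ) = G (x.shift μ)) : nabla ξ U μ F x = nabla ξ V μ G x := by
  unfold nabla
  rw [hU, h0, h1]

/-- `e^{−X} ∈ SL(N, ℂ)` for traceless `X` (Liouville `det e^{Y} = e^{tr Y}`). [cite: Balaban1987RG1, p.252 (Gᶜ = SL(N,ℂ))] -/
theorem expUnit_neg_mem_Gc_of_trace {X : MatA N} (hX : Matrix.trace X = 0) : Beta.BackgroundVertices.expUnit ℂ (-X) ∈ (suModel N).Gc := by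
  rw [mem_suModel_Gc]
  show Matrix.det (NormedSpace.exp (-X)) = 1
  rw [Literature.Analysis.Matrix.det_exp_eq_exp_trace, Matrix.trace_neg, hX, neg_zero, NormedSpace.exp_zero]

/-- `𝔰𝔩(N, ℂ)` is `Ad(GL(N, ℂ))`-stable: `tr(uXu⁻¹) = tr X`. [cite: Balaban1987RG1, (1.10) p.262] -/
theorem conj_mem_gc_of_mem (u : (MatA N)ˣ) {X : MatA N} (hX : X ∈ (suModel N).gc) : (u : MatA N) * X * ((u⁻¹ : (MatA N)ˣ) : MatA N) ∈ (suModel N).gc := by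
  rw [mem_suModel_gc] at hX ⊢
  rw [Matrix.trace_units_conj, hX]

end Small

/-! ## §2 Both transport clauses from numerics and the remaining analytic letters -/

section Record

variable (F : T4Family) (N M k : ℕ) [NeZero N]

/-- ★★★★★ **BOTH TRANSPORT CLAUSES OF N18's READING AT THE TABLE OF RECORD FROM NUMERICS AND THE REMAINING ANALYTIC LETTERS** — FILE 7's ★★★★ with the per-point
letters `hUGc` (FILE B), `Factors`, `CondI`, `A′ ∈ 𝔤ᶜ`, `|A′| ≤ a`, `|∇_{U_A}A′| ≤ a₁` (FILES D∕E∕F; `a = 2ρ_j∕η_j`, crude `a₁ = 2a∕η_j`, `ρ_j = 22·(r_j + ((1+4η_{j+1}α₁)^ℓ − 1))`)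
and the `𝔤ᶜ ∕ Gᶜ`-clauses of the comb generator DISCHARGED.  Models of record: `(Sg k).𝓜 = (Sg (k+1)).𝓜 = suModel N`.  Displayed: `hGc`, `0 ≤ cB`, `0 < M`, `hα`, run B's top-radius
numerics (FILE 7), the per-step numerics of FILES B∕D∕E∕F (`hξ₁ … h1A`), and PER TABLE POINT `(j, Y, Φ)`, for every factorisation `Φ.U = (exp iη_{j+1}A′)·U` with (i) at
`α₀(k+1)(j+1)` and (ii) at `α₁(k+1)(j+1)` on run B's frame, the REMAINING LETTERS `hrest` on `U_A := fieldShift (avgUnits U)`, `A′_A := (iη_j)⁻¹ log(Ū·U_A⁻¹)`: a traceless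
comb generator `l` with `|l| ≤ η_jδ₀` on `Y`, `|∇_{U_A} l| ≤ η_jδ₁` on `Y`'s unit steps, the plaquette letter `|∂Ū − 1| < α₀A(j)·η_j²` on `Y`'s plaquettes, the cancelled sums
`< s₀`, `< s₁`, and the side conditions of FILE 7 at `(a, a₁, α₀A j)`.  Conclusion VERBATIM FILE 7's. [cite: Balaban1987RG1, (0.21)-(0.25) pp.256-257, (1.10)-(1.16) p.262; Balaban1985Averaging, Props. 1-3 pp.26-36] -/
theorem admTransport_spaceOfRecord_unit_ofRecord_orbit_of_analyticLetters (Sg : ℕ → Setting (MatA N) (Node00.SU N)) (α₀ α₁ : ℕ → ℕ → ℝ) (α₀A : ℕ → ℝ)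
    (hMA : (Sg k).𝓜 = suModel N) (hMB : (Sg (k + 1)).𝓜 = suModel N)
    (hGc : (Sg (k + 1)).𝓜.Gc ≤ (Sg k).𝓜.Gc)
    (hcB : 0 ≤ (Sg k).cB) (hcBB : 0 ≤ (Sg (k + 1)).cB) (hM : 0 < M) (ha : 0 ≤ α₀ (k + 1) 0)
    (haδ : (((((F.P (k + 1)).d + 2) * (F.P (k + 1)).L : ℕ) : ℝ) ^ 2 / 4) * α₀ (k + 1) 0 < deltaSU (Fin N))
    (hα : ∀ j, 0 < α₀ k j) (hα0B : ∀ j, 0 ≤ α₀ (k + 1) j) (hα1B : ∀ j, 0 ≤ α₁ (k + 1) j) (hα0A : ∀ j, 0 < α₀A j)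
    -- per-step numerics of FILES B ∕ D ∕ E ∕ F
    (hξ₁ : ∀ j, (F.P (k + 1)).eta (j + 1) * α₁ (k + 1) (j + 1) ≤ 1 / 4)
    (hsm : ∀ j, (((((F.P (k + 1)).d + 2) * (F.P (k + 1)).L : ℕ) : ℝ) ^ 2 / 4) * (α₀ (k + 1) (j + 1) * (F.P (k + 1)).eta (j + 1) ^ 2) +
        ((1 + 2 * (2 * ((F.P (k + 1)).eta (j + 1) * α₁ (k + 1) (j + 1)))) ^ (((F.P (k + 1)).d + 2) * (F.P (k + 1)).L) - 1) ≤ 1 / 2)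
    (hguard2 : ∀ j, (((((F.P (k + 1)).d + 2) * (F.P (k + 1)).L : ℕ) : ℝ) ^ 2 / 4) * (α₀ (k + 1) (j + 1) * (F.P (k + 1)).eta (j + 1) ^ 2) < deltaSU (Fin N))
    (hguard4 : ∀ j, (((((F.P (k + 1)).d + 4) * (F.P (k + 1)).L : ℕ) : ℝ) ^ 2 / 4) * (α₀ (k + 1) (j + 1) * (F.P (k + 1)).eta (j + 1) ^ 2) ≤ deltaSU (Fin N) / 2)
    (hρ3 : ∀ j, 22 * ((((((F.P (k + 1)).d + 2) * (F.P (k + 1)).L : ℕ) : ℝ) ^ 2 / 4) * (α₀ (k + 1) (j + 1) * (F.P (k + 1)).eta (j + 1) ^ 2) +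
        ((1 + 2 * (2 * ((F.P (k + 1)).eta (j + 1) * α₁ (k + 1) (j + 1)))) ^ (((F.P (k + 1)).d + 2) * (F.P (k + 1)).L) - 1)) ≤ 1 / 3)
    (hρπ : ∀ j, (N : ℝ) * (22 * ((((((F.P (k + 1)).d + 2) * (F.P (k + 1)).L : ℕ) : ℝ) ^ 2 / 4) * (α₀ (k + 1) (j + 1) * (F.P (k + 1)).eta (j + 1) ^ 2) +
        ((1 + 2 * (2 * ((F.P (k + 1)).eta (j + 1) * α₁ (k + 1) (j + 1)))) ^ (((F.P (k + 1)).d + 2) * (F.P (k + 1)).L) - 1))) < Real.pi)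
    (h3 : ∀ j, (((((F.P (k + 1)).d + 2) * (F.P (k + 1)).L : ℕ) : ℝ) ^ 2 / 2) * (α₀ (k + 1) (j + 1) * (F.P (k + 1)).eta (j + 1) ^ 2) +
        ((1 + 2 * (2 * ((F.P (k + 1)).eta (j + 1) * α₁ (k + 1) (j + 1)))) ^ (((F.P (k + 1)).d + 2) * (F.P (k + 1)).L) - 1) ≤ 1 / 3)
    (hπ : ∀ j, (N : ℝ) * ((((((F.P (k + 1)).d + 2) * (F.P (k + 1)).L : ℕ) : ℝ) ^ 2 / 2) * (α₀ (k + 1) (j + 1) * (F.P (k + 1)).eta (j + 1) ^ 2) +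
        ((1 + 2 * (2 * ((F.P (k + 1)).eta (j + 1) * α₁ (k + 1) (j + 1)))) ^ (((F.P (k + 1)).d + 2) * (F.P (k + 1)).L) - 1)) < Real.pi)
    (hplaqA : ∀ j, ((F.P (k + 1)).L : ℝ) ^ 2 * (α₀ (k + 1) (j + 1) * (F.P (k + 1)).eta (j + 1) ^ 2) +
        143 * ((((((F.P (k + 1)).d + 4) * (F.P (k + 1)).L : ℕ) : ℝ) ^ 2 / 4) * (α₀ (k + 1) (j + 1) * (F.P (k + 1)).eta (j + 1) ^ 2)) ^ 2 < α₀A j * (F.P k).eta j ^ 2)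
    (h48 : ∀ j, 48 * (((((F.P (k + 1)).d + 2) * (F.P (k + 1)).L : ℕ) : ℝ) * ((F.P (k + 1)).eta (j + 1) * ((Sg (k + 1)).cB * α₀ (k + 1) (j + 1)))) ≤ 1)
    (hN : ∀ j, 4 * (((((F.P (k + 1)).d + 2) * (F.P (k + 1)).L : ℕ) : ℝ) * ((F.P (k + 1)).eta (j + 1) * ((Sg (k + 1)).cB * α₀ (k + 1) (j + 1)))) < deltaSU (Fin N))
    (hπc : ∀ j, (N : ℝ) * (2 * ((F.P (k + 1)).eta (j + 1) * ((Sg (k + 1)).cB * α₀ (k + 1) (j + 1)))) < Real.pi)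
    (h1A : ∀ j, ((F.P (k + 1)).L : ℝ) * ((Sg (k + 1)).cB * α₀ (k + 1) (j + 1)) +
        3200 * (((((F.P (k + 1)).d + 2) * (F.P (k + 1)).L : ℕ) : ℝ)) ^ 2 * (F.P (k + 1)).eta (j + 1) * ((Sg (k + 1)).cB * α₀ (k + 1) (j + 1)) ^ 2 <
      (F.P (k + 1)).L * ((Sg k).cB * α₀A j))
    -- the remaining analytic letters, per table point and per factorisation of run B's pair
    (hrest : ∀ (j : ℕ) (Y : (domSys (F.P k) M j).Dom) (Φ : FieldPair (F.P (k + 1)) 0 (MatA N)ˣ (MatA N))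
        (U : PBond (F.P (k + 1)) 0 → (MatA N)ˣ) (A' : PBond (F.P (k + 1)) 0 → MatA N),
      Factors (StepConsts.ofParams (F.P (k + 1)) (Sg (k + 1)).cB (j + 1)) Φ.U U A' →
      CondI (suModel N) (frameI (Residual.unit (F.P (k + 1)) (MatA N)) M (j + 1) (domSites (F.P (k + 1)) M (j + 1) (pairOfRecord F M k ⟨j, Y⟩).2))
        (StepConsts.ofParams (F.P (k + 1)) (Sg (k + 1)).cB (j + 1)) (α₀ (k + 1) (j + 1)) U →
      CondII (suModel N) (frameI (Residual.unit (F.P (k + 1)) (MatA N)) M (j + 1) (domSites (F.P (k + 1)) M (j + 1) (pairOfRecord F M k ⟨j, Y⟩).2)).X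
        (StepConsts.ofParams (F.P (k + 1)) (Sg (k + 1)).cB (j + 1)) (α₁ (k + 1) (j + 1)) U A' →
      ∃ (l : Site (F.P k) 0 → MatA N) (δ₀ δ₁ s₀ s₁ : ℝ),
        0 ≤ δ₀ ∧
        (StepConsts.ofParams (F.P k) (Sg k).cB j).ξ *
            (2 * (22 * ((((((F.P (k + 1)).d + 2) * (F.P (k + 1)).L : ℕ) : ℝ) ^ 2 / 4) * (α₀ (k + 1) (j + 1) * (F.P (k + 1)).eta (j + 1) ^ 2) +
              ((1 + 2 * (2 * ((F.P (k + 1)).eta (j + 1) * α₁ (k + 1) (j + 1)))) ^ (((F.P (k + 1)).d + 2) * (F.P (k + 1)).L) - 1))) / (F.P k).eta j + 2 * δ₀) ≤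
          1 / 16 ∧
        Real.exp (2 * ((StepConsts.ofParams (F.P k) (Sg k).cB j).ξ * δ₀)) * α₀A j ≤ α₀ k j ∧
        s₀ + 4 * (StepConsts.ofParams (F.P k) (Sg k).cB j).ξ * δ₀ *
            (2 * (22 * ((((((F.P (k + 1)).d + 2) * (F.P (k + 1)).L : ℕ) : ℝ) ^ 2 / 4) * (α₀ (k + 1) (j + 1) * (F.P (k + 1)).eta (j + 1) ^ 2) +
              ((1 + 2 * (2 * ((F.P (k + 1)).eta (j + 1) * α₁ (k + 1) (j + 1)))) ^ (((F.P (k + 1)).d + 2) * (F.P (k + 1)).L) - 1))) / (F.P k).eta j + δ₀) ≤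
          α₁ k j ∧
        s₁ + (4 * (StepConsts.ofParams (F.P k) (Sg k).cB j).ξ *
              (δ₀ * (2 * (2 * (22 * ((((((F.P (k + 1)).d + 2) * (F.P (k + 1)).L : ℕ) : ℝ) ^ 2 / 4) * (α₀ (k + 1) (j + 1) * (F.P (k + 1)).eta (j + 1) ^ 2) +
                ((1 + 2 * (2 * ((F.P (k + 1)).eta (j + 1) * α₁ (k + 1) (j + 1)))) ^ (((F.P (k + 1)).d + 2) * (F.P (k + 1)).L) - 1))) / (F.P k).eta j) / (F.P k).eta j) +
                (2 * (22 * ((((((F.P (k + 1)).d + 2) * (F.P (k + 1)).L : ℕ) : ℝ) ^ 2 / 4) * (α₀ (k + 1) (j + 1) * (F.P (k + 1)).eta (j + 1) ^ 2) +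
                  ((1 + 2 * (2 * ((F.P (k + 1)).eta (j + 1) * α₁ (k + 1) (j + 1)))) ^ (((F.P (k + 1)).d + 2) * (F.P (k + 1)).L) - 1))) / (F.P k).eta j) *
                  (2 * (StepConsts.ofParams (F.P k) (Sg k).cB j).ξ * α₀A j * δ₀ + δ₁)) +
            4 * (StepConsts.ofParams (F.P k) (Sg k).cB j).ξ *
              (((2 * (22 * ((((((F.P (k + 1)).d + 2) * (F.P (k + 1)).L : ℕ) : ℝ) ^ 2 / 4) * (α₀ (k + 1) (j + 1) * (F.P (k + 1)).eta (j + 1) ^ 2) +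
                  ((1 + 2 * (2 * ((F.P (k + 1)).eta (j + 1) * α₁ (k + 1) (j + 1)))) ^ (((F.P (k + 1)).d + 2) * (F.P (k + 1)).L) - 1))) / (F.P k).eta j) +
                  (9 / 8) * δ₀) * δ₁ +
                δ₀ * ((1 + 4 * ((StepConsts.ofParams (F.P k) (Sg k).cB j).ξ * δ₀)) *
                    (2 * (2 * (22 * ((((((F.P (k + 1)).d + 2) * (F.P (k + 1)).L : ℕ) : ℝ) ^ 2 / 4) * (α₀ (k + 1) (j + 1) * (F.P (k + 1)).eta (j + 1) ^ 2) +
                      ((1 + 2 * (2 * ((F.P (k + 1)).eta (j + 1) * α₁ (k + 1) (j + 1)))) ^ (((F.P (k + 1)).d + 2) * (F.P (k + 1)).L) - 1))) / (F.P k).eta j) /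
                      (F.P k).eta j) +
                  (1 + 4 * ((StepConsts.ofParams (F.P k) (Sg k).cB j).ξ *
                    (2 * (22 * ((((((F.P (k + 1)).d + 2) * (F.P (k + 1)).L : ℕ) : ℝ) ^ 2 / 4) * (α₀ (k + 1) (j + 1) * (F.P (k + 1)).eta (j + 1) ^ 2) +
                      ((1 + 2 * (2 * ((F.P (k + 1)).eta (j + 1) * α₁ (k + 1) (j + 1)))) ^ (((F.P (k + 1)).d + 2) * (F.P (k + 1)).L) - 1))) / (F.P k).eta j))) *
                    (2 * (StepConsts.ofParams (F.P k) (Sg k).cB j).ξ * α₀A j * δ₀ + δ₁)))) ≤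
          α₁ k j ∧
        (∀ x, Matrix.trace (l x) = 0) ∧
        (∀ x ∈ domSites (F.P k) M j Y, ‖l x‖ ≤ (StepConsts.ofParams (F.P k) (Sg k).cB j).ξ * δ₀) ∧
        (∀ (x : Site (F.P k) 0) (μ : Fin (F.P k).d), x ∈ domSites (F.P k) M j Y → x.shift μ ∈ domSites (F.P k) M j Y →
          ‖nabla (StepConsts.ofParams (F.P k) (Sg k).cB j).ξ (fieldShift (sitesPerDir_ladder F (K := k) (j := 0) rfl rfl) (avgUnits U)) μ l x‖ ≤
            (StepConsts.ofParams (F.P k) (Sg k).cB j).ξ * δ₁) ∧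
        (∀ p ∈ (frameI (Residual.unit (F.P k) (MatA N)) M j (domSites (F.P k) M j Y)).X.plaqs,
          ‖(↑(plaq (TΦOfRecord F N k Φ).U p) : MatA N) - 1‖ < α₀A j * (StepConsts.ofParams (F.P k) (Sg k).cB j).ξ ^ 2) ∧
        (∀ b ∈ (frameI (Residual.unit (F.P k) (MatA N)) M j (domSites (F.P k) M j Y)).X.bonds,
          ‖(I * ((F.P k).eta j : ℂ))⁻¹ • mlog ((((TΦOfRecord F N k Φ).U b : (MatA N)ˣ) : MatA N) *
              (((fieldShift (sitesPerDir_ladder F (K := k) (j := 0) rfl rfl) (avgUnits U) b)⁻¹ : (MatA N)ˣ) : MatA N)) -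
            I • nabla (StepConsts.ofParams (F.P k) (Sg k).cB j).ξ (fieldShift (sitesPerDir_ladder F (K := k) (j := 0) rfl rfl) (avgUnits U)) b.dir l b.src‖ < s₀) ∧
        (∀ q ∈ (frameI (Residual.unit (F.P k) (MatA N)) M j (domSites (F.P k) M j Y)).X.dpairs,
          ‖nabla (StepConsts.ofParams (F.P k) (Sg k).cB j).ξ (fieldShift (sitesPerDir_ladder F (K := k) (j := 0) rfl rfl) (avgUnits U)) q.2.1
              (fun y => (I * ((F.P k).eta j : ℂ))⁻¹ • mlog ((((TΦOfRecord F N k Φ).U ⟨y, q.2.2⟩ : (MatA N)ˣ) : MatA N) *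
                  (((fieldShift (sitesPerDir_ladder F (K := k) (j := 0) rfl rfl) (avgUnits U) ⟨y, q.2.2⟩)⁻¹ : (MatA N)ˣ) : MatA N)) -
                I • nabla (StepConsts.ofParams (F.P k) (Sg k).cB j).ξ (fieldShift (sitesPerDir_ladder F (K := k) (j := 0) rfl rfl) (avgUnits U)) q.2.2 l y) q.1‖ <
            s₁)) :
    (∀ (X : Node00.W1.Dom (F.P k) M) (ψ : CPair (F.P (k + 1)) (MatA N)),
        ψ ∈ spaceOfRecord (M := M) (Sg (k + 1)) (Residual.unit (F.P (k + 1)) (MatA N)) (α₀ (k + 1)) (α₁ (k + 1)) (pairOfRecord F M k X).1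
            (pairOfRecord F M k X).2 →
          TcfgOfRecord F N k ψ ∈ spaceOfRecord (M := M) (Sg k) (Residual.unit (F.P k) (MatA N)) (α₀ k) (α₁ k) X.1 X.2) ∧
      ∀ U : GaugeField (F.P (k + 1)) 0 (Node00.SU N),
        (∀ (j : ℕ) (Y : (domSys (F.P (k + 1)) M j).Dom),
            ofBackgroundC (ιSU N) U ∈ spaceOfRecord (M := M) (Sg (k + 1)) (Residual.unit (F.P (k + 1)) (MatA N)) (α₀ (k + 1)) (α₁ (k + 1)) j Y) →
          ∀ (j : ℕ) (Y : (domSys (F.P k) M j).Dom),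
            ofBackgroundC (ιSU N) (transportRaw F k (Node00.avOfRecord F N (k + 1) 0) U) ∈
              spaceOfRecord (M := M) (Sg k) (Residual.unit (F.P k) (MatA N)) (α₀ k) (α₁ k) j Y := by
  have hξpos : ∀ j, 0 < (StepConsts.ofParams (F.P k) (Sg k).cB j).ξ := fun j => by
    show 0 < (F.P k).eta j
    exact pow_pos (inv_pos.mpr (Nat.cast_pos.mpr (F.P k).L_pos)) j
  refine admTransport_spaceOfRecord_unit_ofRecord_orbit_of_letters F N M k Sg α₀ α₁ hGc (fun g hg => ?_) ?_ (fun g hg X hX => ?_) (fun j X hX Y hY hs => ?_)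
    hcB hM ha haδ hα fun j Y Φ hΦ => ?_
  · rw [hMA] at hg; exact suModel_norm_le g hg
  · rw [hMA]; exact suModel_G_le_Gc
  · rw [hMA] at hg hX ⊢; exact suModel_gc_conj g hg X hX
  · rw [hMA] at hX hY ⊢; exact suModel_gc_newPot (le_of_lt (hξpos j)) X hX Y hY hs
  -- the table point: run B's pair
  rw [hMB] at hΦ
  have hsat := hΦ
  obtain ⟨-, -, U, A', hf, hI, hII, -⟩ := hΦ
  obtain ⟨l, δ₀, δ₁, s₀, s₁, hδ₀, hs, hα₀', hα₁'0, hα₁'1, hltr, hl0, hl1, hplaq, hS0, hS1⟩ := hrest j Y Φ U A' hf hI hII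
  -- the discharged block: factorisation + condition (i) + 𝔤ᶜ + sizes
  obtain ⟨UA, AA, hfac, hcondI, heq, hgc, hA, hA1⟩ := exists_factors_condI_TΦOfRecord (Residual.unit (F.P (k + 1)) (MatA N)) (Residual.unit (F.P k) (MatA N))
    M j Y hsat hf hI hII (hα0B (j + 1)) (hα1B (j + 1)) (mul_nonneg hcBB (hα0B (j + 1))) (hξ₁ j) (hsm j) (hguard2 j) (hguard4 j) (hρ3 j) (hρπ j)
    (h3 j) (hπ j) (hplaqA j) (h48 j) (hN j) (hπc j) (h1A j)
  have hUGc : ∀ b ∈ (frameI (Residual.unit (F.P k) (MatA N)) M j (domSites (F.P k) M j Y)).X.bonds, (TΦOfRecord F N k Φ).U b ∈ (Sg k).𝓜.Gc := fun b hb => by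
    rw [hMA]
    exact TΦOfRecord_U_mem_suModel_Gc_of_satisfiesI_III_frameBond (Residual.unit (F.P (k + 1)) (MatA N)) M j Y hsat b hb
      (le_of_lt (pow_pos (inv_pos.mpr (Nat.cast_pos.mpr (F.P (k + 1)).L_pos)) _)) (hα0B (j + 1)) (hα1B (j + 1)) (hξ₁ j) (h3 j) (hπ j)
  refine ⟨UA, AA, l, α₀A j, α₀A j, _, _, δ₀, δ₁, s₀, s₁, (hα0A j).le, hα0A j, ?_, hδ₀, hs, hα₀', hα₀', hα₁'0, hα₁'1, hUGc, hfac, ?_, ?_, hA, hA1, hplaq,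
    ?_, ?_, ?_, hl0, ?_, ?_, ?_⟩
  · -- `0 ≤ a`
    have hρ0 : 0 ≤ 22 * ((((((F.P (k + 1)).d + 2) * (F.P (k + 1)).L : ℕ) : ℝ) ^ 2 / 4) * (α₀ (k + 1) (j + 1) * (F.P (k + 1)).eta (j + 1) ^ 2) +
        ((1 + 2 * (2 * ((F.P (k + 1)).eta (j + 1) * α₁ (k + 1) (j + 1)))) ^ (((F.P (k + 1)).d + 2) * (F.P (k + 1)).L) - 1)) := by
      have hηα : 0 ≤ (F.P (k + 1)).eta (j + 1) * α₁ (k + 1) (j + 1) :=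
        mul_nonneg (le_of_lt (pow_pos (inv_pos.mpr (Nat.cast_pos.mpr (F.P (k + 1)).L_pos)) (j + 1))) (hα1B (j + 1))
      have h1 : (1 : ℝ) ≤ (1 + 2 * (2 * ((F.P (k + 1)).eta (j + 1) * α₁ (k + 1) (j + 1)))) ^ (((F.P (k + 1)).d + 2) * (F.P (k + 1)).L) :=
        one_le_pow₀ (by linarith)
      have h2 : 0 ≤ (((((F.P (k + 1)).d + 2) * (F.P (k + 1)).L : ℕ) : ℝ) ^ 2 / 4) * (α₀ (k + 1) (j + 1) * (F.P (k + 1)).eta (j + 1) ^ 2) :=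
        mul_nonneg (by positivity) (mul_nonneg (hα0B (j + 1)) (sq_nonneg _))
      nlinarith
    have hη : 0 < (F.P k).eta j := hξpos j
    exact div_nonneg (mul_nonneg zero_le_two hρ0) hη.le
  · rw [hMA]; exact hcondI
  · intro b hb; rw [hMA]; exact hgc b hb
  · intro x _; rw [hMA]; exact mem_suModel_gc.mpr (hltr x)
  · intro x; rw [hMA]; exact expUnit_neg_mem_Gc_of_trace (hltr x)
  · intro x _ X hX; rw [hMA] at hX ⊢; exact conj_mem_gc_of_mem _ hX
  · -- `|∇_{U_A} l| ≤ ξδ₁` on `Y`'s unit steps: `U_A = fieldShift (avgUnits U)` on the frame bond `⟨x, μ⟩`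
    intro x μ hx hxμ
    rw [nabla_congr (V := fieldShift (sitesPerDir_ladder F (K := k) (j := 0) rfl rfl) (avgUnits U)) (G := l) ((heq ⟨x, μ⟩ ⟨hx, hxμ⟩).1) rfl rfl]
    exact hl1 x μ hx hxμ
  · -- the cancelled sum `s₀`
    intro b hb
    obtain ⟨hUA, hAA⟩ := heq b hb
    rw [hAA, nabla_congr (V := fieldShift (sitesPerDir_ladder F (K := k) (j := 0) rfl rfl) (avgUnits U)) (G := l)
      ((heq ⟨b.src, b.dir⟩ hb).1) rfl rfl]
    exact hS0 b hb
  · -- the cancelled sum `s₁`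
    intro q hq
    obtain ⟨h0, hμ, hν, hμν⟩ := hq
    have hbμ : (⟨q.1, q.2.1⟩ : PBond (F.P k) 0) ∈ (frameI (Residual.unit (F.P k) (MatA N)) M j (domSites (F.P k) M j Y)).X.bonds := ⟨h0, hμ⟩
    have hbν : (⟨q.1, q.2.2⟩ : PBond (F.P k) 0) ∈ (frameI (Residual.unit (F.P k) (MatA N)) M j (domSites (F.P k) M j Y)).X.bonds := ⟨h0, hν⟩
    have hbμν : (⟨q.1.shift q.2.1, q.2.2⟩ : PBond (F.P k) 0) ∈ (frameI (Residual.unit (F.P k) (MatA N)) M j (domSites (F.P k) M j Y)).X.bonds := ⟨hμ, hμν⟩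
    rw [nabla_congr (V := fieldShift (sitesPerDir_ladder F (K := k) (j := 0) rfl rfl) (avgUnits U))
      (G := fun y => (I * ((F.P k).eta j : ℂ))⁻¹ • mlog ((((TΦOfRecord F N k Φ).U ⟨y, q.2.2⟩ : (MatA N)ˣ) : MatA N) *
          (((fieldShift (sitesPerDir_ladder F (K := k) (j := 0) rfl rfl) (avgUnits U) ⟨y, q.2.2⟩)⁻¹ : (MatA N)ˣ) : MatA N)) -
        I • nabla (StepConsts.ofParams (F.P k) (Sg k).cB j).ξ (fieldShift (sitesPerDir_ladder F (K := k) (j := 0) rfl rfl) (avgUnits U)) q.2.2 l y)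
      ((heq _ hbμ).1) ?_ ?_]
    · exact hS1 q ⟨h0, hμ, hν, hμν⟩
    · show AA ⟨q.1, q.2.2⟩ - I • nabla _ UA q.2.2 l q.1 = _
      rw [(heq _ hbν).2, nabla_congr (V := fieldShift (sitesPerDir_ladder F (K := k) (j := 0) rfl rfl) (avgUnits U)) (G := l) ((heq _ hbν).1) rfl rfl]
    · show AA ⟨q.1.shift q.2.1, q.2.2⟩ - I • nabla _ UA q.2.2 l (q.1.shift q.2.1) = _
      rw [(heq _ hbμν).2, nabla_congr (V := fieldShift (sitesPerDir_ladder F (K := k) (j := 0) rfl rfl) (avgUnits U)) (G := l) ((heq _ hbμν).1) rfl rfl]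

end Record

end YMDAG.N18.TransportOfRecord

end
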